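import Summits.ResolutionOfSingularities.ResolutionOfSingularities.Theorems.SharpStrataSepExcModelsModelSpreadsAvatars
import HarnessLib

/-!
# Separable regular birational local models spread along the stratum, III: the stub

Third of three files: the stub `stub_modelSpreads` of the line `Cruxes/SepExcModels/Lines/birth.lean`
(crux `SharpStrata.SepExcModels`), the algebraic-geometry content of "the sharp strata are closed"
(Benito–Piltant–Reguera 2022, Lemma 4.2 / Prop. 2.1 in valuative dress), PROVED.

Let `Y` be an integral scheme locally of finite type over a field `k`, `w ∈ Y`, and let
`B = 𝒪_{Y,w}[s] ⊆ K(Y)` be a finitely generated birational local model carrying a prime `𝔮`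
over `m_w` with `B_𝔮` regular and `(B/𝔮)[1/g]` smooth over `κ(w)` for some `g ∉ 𝔮`. Then there
is an open neighbourhood `U` of `w` such that every point `w'` of `U ∩ cl{w}` carries a model of
the same kind (with the same `s`).

* `exists_open_forall_model` — the affine form: choose `Spec A ∋ w`, `P` the prime of `w`, spread
  `B` to `C = A[s] ⊆ K(Y)` (`B = C_P`, part I), contract `𝔮` to a prime `Q` of `C` over `P` with
  `C_Q = B_𝔮` regular; `D = C/Q` is smooth over `A/P` at its generic point (part II); the regular
  locus of `C` is open (fields are J-2, `isOpen_regularLocus_of_finiteType_field`); spread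
  (part I) and conclude at every `P' ⊇ P` of the good open (part II).
* `stub_modelSpreads` — transport to the scheme along the open immersion `Spec A → Y`
  (`𝒪_{Y,x} = A_{P_x}` inside `K(Y)`, and `w ⤳ w'` iff `P_w ⊆ P_{w'}`).

## Sources

* A. Benito, O. Piltant, A. J. Reguera, *Small irreducible components of arc spaces in positive
  characteristic*, J. Pure Appl. Algebra 226 (2022) 107113, Lemma 4.2, Prop. 2.1, Prop. 4.3.
  [BenitoPiltantReguera2022]
* H. Matsumura, *Commutative Ring Theory*, CUP 1986, §30, Cor. to Thm. 30.5 (fields are J-2).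
  [Matsumura1987]
-/

noncomputable section

-- single-problem summit: the doubled namespace component `ResolutionOfSingularities` is forced
set_option linter.dupNamespace false

open CategoryTheory AlgebraicGeometry TopologicalSpace Topology
open Literature.AlgebraicGeometry.Resolution

namespace Summit.ResolutionOfSingularities.ResolutionOfSingularities.Theorems.SepExcModels.ModelSpreads

open IsLocalRing

/-! ## Assembly over an affine chart -/

/-- **Propagation of a separable regular local model over an affine chart** (BPR Lemma 4.2 /
Prop. 2.1, affine form). Let `A` be a finitely generated algebra over a field `k` inside a field
`K`, `R = A_P ⊆ K`, and `B = R[s]` (`s ⊆ K` finite) with a prime `𝔮` over `m_R`, `B_𝔮` regular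
and `(B/𝔮)[1/g]` smooth over `κ(P)`. Then there is an open `W ∋ P` of `Spec A` such that for
every `P' ∈ W` with `P ⊆ P'` and every localisation `R' = A_{P'} ⊆ K`, the ring `R'[s]` carries
a prime `𝔮'` over `m_{R'}` with `R'[s]_{𝔮'}` regular and `(R'[s]/𝔮')[1/g']` smooth over `κ(P')`
for some `g' ∉ 𝔮'`. [cite: BenitoPiltantReguera2022, Lemma 4.2 and Prop. 2.1] -/
theorem exists_open_forall_model {k A K R : Type} [Field k] [CommRing A] [Algebra k A]
    [Algebra.FiniteType k A] [Field K] [Algebra A K] [CommRing R] [IsLocalRing R] [Algebra A R]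
    [Algebra R K] [IsScalarTower A R K] (P : Ideal A) [P.IsPrime] [IsLocalization.AtPrime R P]
    (s : Finset K) (𝔮 : Ideal (Algebra.adjoin R (s : Set K))) [𝔮.IsPrime]
    (hle : maximalIdeal R ≤ 𝔮.comap (algebraMap R (Algebra.adjoin R (s : Set K))))
    (hreg : IsRegularLocalRing (Localization.AtPrime 𝔮))
    (g : Algebra.adjoin R (s : Set K)) (hg : g ∉ 𝔮)
    (hsm : @Algebra.Smooth (R ⧸ maximalIdeal R) _ (Localization.Away (Ideal.Quotient.mk 𝔮 g)) _
      ((algebraMap _ (Localization.Away (Ideal.Quotient.mk 𝔮 g))).comp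
        (Ideal.quotientMap 𝔮 (algebraMap R (Algebra.adjoin R (s : Set K))) hle)).toAlgebra) :
    ∃ W : Set (PrimeSpectrum A), IsOpen W ∧ (⟨P, inferInstance⟩ : PrimeSpectrum A) ∈ W ∧
      ∀ P' : PrimeSpectrum A, P' ∈ W → P ≤ P'.asIdeal →
        ∀ (R' : Type) [CommRing R'] [IsLocalRing R'] [Algebra A R']
          [IsLocalization.AtPrime R' P'.asIdeal] [Algebra R' K] [IsScalarTower A R' K],
          ∃ (𝔮' : Ideal (Algebra.adjoin R' (s : Set K))) (_ : 𝔮'.IsPrime)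
            (hle' : maximalIdeal R' ≤ 𝔮'.comap (algebraMap R' (Algebra.adjoin R' (s : Set K)))),
            IsRegularLocalRing (Localization.AtPrime 𝔮') ∧
              ∃ g' : Algebra.adjoin R' (s : Set K), g' ∉ 𝔮' ∧
                @Algebra.Smooth (R' ⧸ maximalIdeal R') _
                  (Localization.Away (Ideal.Quotient.mk 𝔮' g')) _
                  ((algebraMap _ (Localization.Away (Ideal.Quotient.mk 𝔮' g'))).comp
                    (Ideal.quotientMap 𝔮' (algebraMap R' (Algebra.adjoin R' (s : Set K)))
                      hle')).toAlgebra := by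
  classical
  haveI : IsNoetherianRing A := Algebra.FiniteType.isNoetherianRing k A
  -- the inclusion `C = A[s] → B = R[s]`
  have hCB : Algebra.adjoin A (s : Set K) ≤ (Algebra.adjoin R (s : Set K)).restrictScalars A :=
    Algebra.adjoin_le Algebra.subset_adjoin
  letI algCB : Algebra (Algebra.adjoin A (s : Set K)) (Algebra.adjoin R (s : Set K)) :=
    ({ toFun := fun c => ⟨c.1, hCB c.2⟩, map_one' := rfl, map_mul' := fun _ _ => rfl,
        map_zero' := rfl, map_add' := fun _ _ => rfl } :
      Algebra.adjoin A (s : Set K) →+* Algebra.adjoin R (s : Set K)).toAlgebra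
  have halg : ∀ c : Algebra.adjoin A (s : Set K),
      (algebraMap (Algebra.adjoin A (s : Set K)) (Algebra.adjoin R (s : Set K)) c : K) = c :=
    fun c => rfl
  haveI := IsScalarTower.of_algebraMap_eq (R := A) (S := Algebra.adjoin A (s : Set K))
    (A := Algebra.adjoin R (s : Set K)) fun a => Subtype.ext (by
      rw [halg, Subalgebra.coe_algebraMap, Subalgebra.coe_algebraMap])
  haveI hM : IsLocalization (Algebra.algebraMapSubmonoid (Algebra.adjoin A (s : Set K))
      P.primeCompl) (Algebra.adjoin R (s : Set K)) := isLocalization_adjoin P.primeCompl _ halg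
  -- `Q = 𝔮 ∩ C` lies over `P`
  have hQA : (𝔮.comap (algebraMap (Algebra.adjoin A (s : Set K)) (Algebra.adjoin R (s : Set K)))).comap
      (algebraMap A (Algebra.adjoin A (s : Set K))) = P := by
    apply le_antisymm
    · intro a ha
      by_contra haP
      have hu : IsUnit (algebraMap A (Algebra.adjoin R (s : Set K)) a) := by
        rw [IsScalarTower.algebraMap_apply A R (Algebra.adjoin R (s : Set K))]
        exact (IsLocalization.map_units (M := P.primeCompl) R ⟨a, haP⟩).map _
      rw [Ideal.mem_comap, Ideal.mem_comap, ← IsScalarTower.algebraMap_apply] at ha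
      exact (Ideal.IsPrime.ne_top ‹𝔮.IsPrime›) (Ideal.eq_top_of_isUnit_mem _ ha hu)
    · intro a ha
      rw [Ideal.mem_comap, Ideal.mem_comap, ← IsScalarTower.algebraMap_apply,
        IsScalarTower.algebraMap_apply A R (Algebra.adjoin R (s : Set K)), ← Ideal.mem_comap]
      exact hle ((IsLocalization.AtPrime.to_map_mem_maximal_iff R P a).mpr ha)
  -- `D = C/Q` over `A₀ = A/P`
  letI algAD : Algebra (A ⧸ P) (Algebra.adjoin A (s : Set K) ⧸
      𝔮.comap (algebraMap (Algebra.adjoin A (s : Set K)) (Algebra.adjoin R (s : Set K)))) :=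
    Ideal.Quotient.algebraQuotientOfLEComap hQA.ge
  have hAD : ∀ a : A, algebraMap (A ⧸ P) (Algebra.adjoin A (s : Set K) ⧸
      𝔮.comap (algebraMap (Algebra.adjoin A (s : Set K)) (Algebra.adjoin R (s : Set K))))
      (Ideal.Quotient.mk P a) = Ideal.Quotient.mk _ (algebraMap A _ a) := fun a => rfl
  haveI := IsScalarTower.of_algebraMap_eq (R := A) (S := A ⧸ P) (A := Algebra.adjoin A (s : Set K) ⧸
      𝔮.comap (algebraMap (Algebra.adjoin A (s : Set K)) (Algebra.adjoin R (s : Set K))))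
    fun a => (hAD a).symm
  have hsm0 := isSmoothAt_bot_of_model P (s : Set K) halg 𝔮 hle g hg hsm
  haveI : Algebra.FiniteType A (Algebra.adjoin A (s : Set K)) :=
    Algebra.FiniteType.adjoin_of_finite s.finite_toSet
  haveI : Algebra.FiniteType (A ⧸ P) (Algebra.adjoin A (s : Set K) ⧸
      𝔮.comap (algebraMap (Algebra.adjoin A (s : Set K)) (Algebra.adjoin R (s : Set K)))) :=
    Algebra.FiniteType.of_restrictScalars_finiteType A _ _
  have hinj : Function.Injective (algebraMap (A ⧸ P) (Algebra.adjoin A (s : Set K) ⧸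
      𝔮.comap (algebraMap (Algebra.adjoin A (s : Set K)) (Algebra.adjoin R (s : Set K))))) :=
    Ideal.quotientMap_injective' hQA.le
  -- the regular locus of `C` is open (fields are J-2) and contains `Q`
  letI algkC : Algebra k (Algebra.adjoin A (s : Set K)) :=
    ((algebraMap A (Algebra.adjoin A (s : Set K))).comp (algebraMap k A)).toAlgebra
  haveI := IsScalarTower.of_algebraMap_eq (R := k) (S := A) (A := Algebra.adjoin A (s : Set K))
    fun _ => rfl
  haveI : Algebra.FiniteType k (Algebra.adjoin A (s : Set K)) :=
    Algebra.FiniteType.trans (S := A) ‹_› ‹_›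
  have hRegOpen : IsOpen (regularLocus (Algebra.adjoin A (s : Set K))) :=
    isOpen_regularLocus_of_finiteType_field k _
  have hO : IsOpen (PrimeSpectrum.comap (Ideal.Quotient.mk (𝔮.comap (algebraMap
      (Algebra.adjoin A (s : Set K)) (Algebra.adjoin R (s : Set K))))) ⁻¹'
      regularLocus (Algebra.adjoin A (s : Set K))) :=
    hRegOpen.preimage (PrimeSpectrum.continuous_comap _)
  have hQeq : 𝔮.comap (algebraMap (Algebra.adjoin A (s : Set K)) (Algebra.adjoin R (s : Set K))) =
      (⊥ : Ideal (Algebra.adjoin A (s : Set K) ⧸ 𝔮.comap (algebraMap (Algebra.adjoin A (s : Set K))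
        (Algebra.adjoin R (s : Set K))))).comap (Ideal.Quotient.mk _) := by
    rw [← RingHom.ker_eq_comap_bot, Ideal.mk_ker]
  have hObot : (⟨⊥, Ideal.isPrime_bot⟩ : PrimeSpectrum (Algebra.adjoin A (s : Set K) ⧸
      𝔮.comap (algebraMap (Algebra.adjoin A (s : Set K)) (Algebra.adjoin R (s : Set K))))) ∈
      PrimeSpectrum.comap (Ideal.Quotient.mk (𝔮.comap (algebraMap
        (Algebra.adjoin A (s : Set K)) (Algebra.adjoin R (s : Set K))))) ⁻¹'
        regularLocus (Algebra.adjoin A (s : Set K)) :=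
    (isRegularLocalRing_iff_of_isLocalization (Algebra.algebraMapSubmonoid
      (Algebra.adjoin A (s : Set K)) P.primeCompl) 𝔮 _ hQeq).mp hreg
  -- spread
  obtain ⟨W₀, hW₀, hbotW₀, hW₀prop⟩ := exists_open_separable_fibres hinj _ hO hObot hsm0
  have hind : IsInducing (PrimeSpectrum.comap (Ideal.Quotient.mk P)) :=
    PrimeSpectrum.comap_isInducing_of_surjective _ _ Ideal.Quotient.mk_surjective
  obtain ⟨W, hW, hWW₀⟩ := hind.isOpen_iff.mp hW₀
  refine ⟨W, hW, ?_, ?_⟩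
  · have hbot : PrimeSpectrum.comap (Ideal.Quotient.mk P) ⟨⊥, Ideal.isPrime_bot⟩ =
        (⟨P, inferInstance⟩ : PrimeSpectrum A) := by
      ext1
      rw [PrimeSpectrum.comap_asIdeal, ← RingHom.ker_eq_comap_bot, Ideal.mk_ker]
    rw [← hbot, ← Set.mem_preimage, hWW₀]
    exact hbotW₀
  intro P' hP'W hPP' R' _ _ _ _ _ _
  have hP'range : P' ∈ Set.range (PrimeSpectrum.comap (Ideal.Quotient.mk P)) := by
    rw [range_comap_of_surjective _ _ Ideal.Quotient.mk_surjective, Ideal.mk_ker]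
    exact hPP'
  obtain ⟨p, rfl⟩ := hP'range
  have hpW₀ : p ∈ W₀ := by
    rw [← hWW₀]
    exact hP'W
  obtain ⟨Q₀, hQ₀O, hQ₀p, Z, _, _, y, _, φ, hφ, hyQ₀, hφA, hysm⟩ := hW₀prop p hpW₀
  -- the inclusion `C → B' = R'[s]`
  have hCB' : Algebra.adjoin A (s : Set K) ≤ (Algebra.adjoin R' (s : Set K)).restrictScalars A :=
    Algebra.adjoin_le Algebra.subset_adjoin
  letI algCB' : Algebra (Algebra.adjoin A (s : Set K)) (Algebra.adjoin R' (s : Set K)) :=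
    ({ toFun := fun c => ⟨c.1, hCB' c.2⟩, map_one' := rfl, map_mul' := fun _ _ => rfl,
        map_zero' := rfl, map_add' := fun _ _ => rfl } :
      Algebra.adjoin A (s : Set K) →+* Algebra.adjoin R' (s : Set K)).toAlgebra
  have halg' : ∀ c : Algebra.adjoin A (s : Set K),
      (algebraMap (Algebra.adjoin A (s : Set K)) (Algebra.adjoin R' (s : Set K)) c : K) = c :=
    fun c => rfl
  haveI := IsScalarTower.of_algebraMap_eq (R := A) (S := Algebra.adjoin A (s : Set K))
    (A := Algebra.adjoin R' (s : Set K)) fun a => Subtype.ext (by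
      rw [halg', Subalgebra.coe_algebraMap, Subalgebra.coe_algebraMap])
  -- the avatar `κ(y)` of `κ(Q')`, `Q' = Q₀ ∩ C`
  have hA₁ : Function.Surjective (algebraMap A ((A ⧸ P) ⧸ p.asIdeal)) := fun x => by
    obtain ⟨x, rfl⟩ := Ideal.Quotient.mk_surjective x
    obtain ⟨a, rfl⟩ := Ideal.Quotient.mk_surjective x
    exact ⟨a, rfl⟩
  have hmkQ : (Ideal.Quotient.mk (𝔮.comap (algebraMap (Algebra.adjoin A (s : Set K))
      (Algebra.adjoin R (s : Set K))))).SurjectiveOnStalks :=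
    RingHom.surjectiveOnStalks_of_surjective Ideal.Quotient.mk_surjective
  refine exists_model_at_prime (PrimeSpectrum.comap (Ideal.Quotient.mk P) p).asIdeal (s : Set K)
    s.finite_toSet halg' (Q₀.asIdeal.comap (Ideal.Quotient.mk _)) ?_ hQ₀O
    ((A ⧸ P) ⧸ p.asIdeal) Z hA₁ y hysm (φ.comp (Ideal.Quotient.mk _)) (hφ.comp hmkQ) ?_ ?_
  · -- `Q' ∩ A = P'`
    rw [PrimeSpectrum.comap_asIdeal, Ideal.comap_comap, ← hQ₀p, Ideal.comap_comap]
    rfl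
  · -- `Q' = φ⁻¹(y) ∩ C`
    rw [← Ideal.comap_comap, hyQ₀]
  · -- compatibility with `A`
    intro a
    rw [RingHom.comp_apply, IsScalarTower.algebraMap_apply A (A ⧸ P) ((A ⧸ P) ⧸ p.asIdeal),
      Ideal.Quotient.algebraMap_eq, Ideal.Quotient.algebraMap_eq, ← hφA, hAD]

/-! ## The stub: spreading along the stratum on the scheme -/

/-- **STUB `stub_modelSpreads` (the algebraic-geometry content of `sharpFinite`): a separable
regular birational local model spreads along the stratum** (BPR Lemma 4.2 / Prop. 2.1 in
valuative dress). `Y` integral, locally of finite type over a field, `w ∈ Y` with a finitely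
generated birational local model `B = 𝒪_{Y,w}[s] ⊆ K(Y)`, a prime `𝔮` of `B` over `m_w` with
`B_𝔮` regular, and `g ∉ 𝔮` with `(B/𝔮)[1/g]` smooth over `κ(w)`. Then on an open neighbourhood
`U` of `w`, EVERY point `w'` of the stratum `U ∩ cl{w}` carries such a model (with `s' = s`):
choose an affine open `Spec A ∋ w` (`A` of finite type over `k`), so that `𝒪_{Y,x} = A_{P_x}`
inside `K(Y)` for `x ∈ Spec A`; apply `exists_open_forall_model` and transport the open set of
`Spec A` to `Y` along the open immersion `Spec A → Y` (specialisations `w ⤳ w'` in `Y`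
correspond to inclusions `P_w ⊆ P_{w'}`).
[cite: BenitoPiltantReguera2022, Lemma 4.2, Prop. 2.1, Prop. 4.3] -/
theorem stub_modelSpreads (k : Type) [Field k] (Y : Scheme.{0}) [IsIntegral Y]
    (f : Y ⟶ Spec (.of k)) [LocallyOfFiniteType f] (w : Y) (s : Finset Y.functionField)
    (𝔮 : Ideal (Algebra.adjoin (Y.presheaf.stalk w) (s : Set Y.functionField))) [𝔮.IsPrime]
    (hle : IsLocalRing.maximalIdeal (Y.presheaf.stalk w) ≤
      𝔮.comap (algebraMap (Y.presheaf.stalk w)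
        (Algebra.adjoin (Y.presheaf.stalk w) (s : Set Y.functionField))))
    (hreg : IsRegularLocalRing (Localization.AtPrime 𝔮))
    (g : Algebra.adjoin (Y.presheaf.stalk w) (s : Set Y.functionField)) (hg : g ∉ 𝔮)
    (hsm : @Algebra.Smooth (Y.presheaf.stalk w ⧸ IsLocalRing.maximalIdeal (Y.presheaf.stalk w)) _
      (Localization.Away (Ideal.Quotient.mk 𝔮 g)) _
      ((algebraMap _ (Localization.Away (Ideal.Quotient.mk 𝔮 g))).comp
        (Ideal.quotientMap 𝔮 (algebraMap (Y.presheaf.stalk w)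
          (Algebra.adjoin (Y.presheaf.stalk w) (s : Set Y.functionField))) hle)).toAlgebra) :
    ∃ U : Set Y, IsOpen U ∧ w ∈ U ∧ ∀ w' ∈ U ∩ closure {w},
      ∃ (s' : Finset Y.functionField)
        (𝔮' : Ideal (Algebra.adjoin (Y.presheaf.stalk w') (s' : Set Y.functionField)))
        (_ : 𝔮'.IsPrime)
        (hle' : IsLocalRing.maximalIdeal (Y.presheaf.stalk w') ≤
          𝔮'.comap (algebraMap (Y.presheaf.stalk w')
            (Algebra.adjoin (Y.presheaf.stalk w') (s' : Set Y.functionField)))),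
        IsRegularLocalRing (Localization.AtPrime 𝔮') ∧
          ∃ g' : Algebra.adjoin (Y.presheaf.stalk w') (s' : Set Y.functionField), g' ∉ 𝔮' ∧
            @Algebra.Smooth
              (Y.presheaf.stalk w' ⧸ IsLocalRing.maximalIdeal (Y.presheaf.stalk w')) _
              (Localization.Away (Ideal.Quotient.mk 𝔮' g')) _
              ((algebraMap _ (Localization.Away (Ideal.Quotient.mk 𝔮' g'))).comp
                (Ideal.quotientMap 𝔮' (algebraMap (Y.presheaf.stalk w')
                  (Algebra.adjoin (Y.presheaf.stalk w') (s' : Set Y.functionField)))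
                  hle')).toAlgebra := by
  classical
  -- an affine open neighbourhood `V = Spec A` of `w`; `A` is of finite type over `k`
  obtain ⟨V, hV, hwV, -⟩ := exists_isAffineOpen_mem_and_subset (X := Y) (x := w) (U := ⊤) trivial
  haveI : Nonempty V := ⟨⟨w, hwV⟩⟩
  have hφ : RingHom.FiniteType (f.appLE ⊤ V le_top).hom :=
    HasRingHomProperty.appLE @LocallyOfFiniteType f ‹_› ⟨⊤, isAffineOpen_top _⟩ ⟨V, hV⟩ le_top
  let e : k ≃+* Γ(Spec (.of k), ⊤) := (Scheme.ΓSpecIso (.of k)).commRingCatIsoToRingEquiv.symm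
  have hψ : RingHom.FiniteType (((f.appLE ⊤ V le_top).hom : _ →+* _).comp e.toRingHom) :=
    hφ.comp (RingHom.FiniteType.of_surjective _ e.surjective)
  letI : Algebra k Γ(Y, V) := ((((f.appLE ⊤ V le_top).hom : _ →+* _).comp e.toRingHom)).toAlgebra
  haveI : Algebra.FiniteType k Γ(Y, V) := hψ
  -- the stalk at `w` is the localisation of `A` at the prime of `w`, inside `K(Y)`
  letI := TopCat.Presheaf.algebra_section_stalk Y.presheaf (⟨w, hwV⟩ : V)
  haveI := functionField_isScalarTower Y V ⟨w, hwV⟩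
  haveI := hV.isLocalization_stalk ⟨w, hwV⟩
  obtain ⟨W, hWopen, hPW, hWprop⟩ := exists_open_forall_model (k := k) (K := Y.functionField)
    (hV.primeIdealOf ⟨w, hwV⟩).asIdeal s 𝔮 hle hreg g hg hsm
  -- transport `W ⊆ Spec A` to `Y` along the open immersion `Spec A → Y`
  refine ⟨hV.fromSpec.base '' W, hV.fromSpec.isOpenEmbedding.isOpenMap _ hWopen,
    ⟨_, hPW, hV.fromSpec_primeIdealOf ⟨w, hwV⟩⟩, ?_⟩
  rintro w' ⟨⟨y, hyW, rfl⟩, hw'cl⟩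
  have hyV : hV.fromSpec.base y ∈ V := hV.range_fromSpec.le ⟨y, rfl⟩
  have hy : hV.primeIdealOf ⟨_, hyV⟩ = y :=
    hV.fromSpec.isOpenEmbedding.injective (hV.fromSpec_primeIdealOf ⟨_, hyV⟩)
  -- `w ⤳ w'` in `Y` means `P_w ⊆ P_{w'}` in `Spec A`
  have hsp : w ⤳ hV.fromSpec.base y := specializes_iff_mem_closure.mpr hw'cl
  have hsp' : hV.fromSpec.base (hV.primeIdealOf ⟨w, hwV⟩) ⤳ hV.fromSpec.base y := by
    rwa [hV.fromSpec_primeIdealOf]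
  have hle_P : (hV.primeIdealOf ⟨w, hwV⟩).asIdeal ≤ y.asIdeal :=
    (PrimeSpectrum.le_iff_specializes _ _).mpr
      (hV.fromSpec.isOpenEmbedding.isInducing.specializes_iff.mp hsp')
  -- the stalk at `w'`
  letI := TopCat.Presheaf.algebra_section_stalk Y.presheaf (⟨_, hyV⟩ : V)
  haveI := functionField_isScalarTower Y V ⟨_, hyV⟩
  have hloc := hV.isLocalization_stalk ⟨_, hyV⟩
  rw [hy] at hloc
  haveI := hloc
  exact ⟨s, hWprop y hyW hle_P (Y.presheaf.stalk (hV.fromSpec.base y))⟩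

end Summit.ResolutionOfSingularities.ResolutionOfSingularities.Theorems.SepExcModels.ModelSpreads

end
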